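import Literature.MeasureTheory.Group.FibreCountPullback                 -- ★ Federer's fibre-count pull-back: `exists_measure_apply_eq_lintegral_count_fibre`, `apply_preimage_eq_of_semiconj`, `apply_le_mul_measure_image`, `map_eq_smul_restrict_image_of_count_fibre_eq`, `lintegral_comp_eq_mul_setLIntegral_image`, `apply_eq_zero_of_inter_eq_empty`
import Literature.MeasureTheory.Group.InvariantOrbitMeasureUniqueness    -- ★ Weil's relative uniqueness on one orbit: `exists_measure_prod_eq_mul` (second factor `Y` abstract)
import Literature.MeasureTheory.Group.InvariantQuotientExistence         -- ★ `quotientMeasure`, `smulInvariantMeasure_quotientMeasure`, `quotientMeasure_ne_zero`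
import Literature.Topology.Metrizable.LocallyCompactPolish               -- ★ `polishSpace_of_locallyCompactSpace_of_secondCountableTopology`
import HarnessLib

/-!
# R90-TF · S4 «Ch. 13.1–2», T-WIF road, head M2 (abstract) — THE RADIAL MEASURE OF AN EQUIVARIANT FINITE-FIBRE FAMILY `Ψ : G ⧸ B × S → G`: the Weyl
# integration formula on `Ψ(D)` WITHOUT Jacobians, for ANY parameter space `S` and ANY twist (Harish-Chandra 1970, Lemma 42; Weil 1965; Rogawski 1990, §12.5 pp. 182, 186)

Cell `hodgecm-mathlib`, crux H413 (`stmt-HodgeConjecture-24833`, lane `--supports … --as helper`), route of record `HCCMUnconditional` (no route verbs;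
count-neutral).  Programme R90-TF, section S4 = [Rogawski1990] Ch. 13.1–13.2; seat R90-C131-p03 (g3); head M2 of the HEADS SHEETS `R90/R90-C131-p03/g2/HEADS-TWIF-tube.md` §2 ∕
`R90/R90-C131-p03/g3/HEADS-TWIF-tube.v3-M1M2.md` §1 («M2 FIRST AND ABSTRACT», S4 dealer K2E2-plan (g7) 00:50:28Z «after M4: M1 TWIST-FAM ∕ M2 TWIST-RADIAL generic twins»).  GENERIC —
no S4 token: this is ★ `Literature.MeasureTheory.Group.ConjugationWeylVanishing` with the torus FACTOR `T` abstracted to an arbitrary locally compact second countable Hausdorff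
space `S` and the conjugation `x t x⁻¹` abstracted to any continuous `Ψ` with `Ψ(c • q, s) = c · Ψ(q, s) · e(c)`; its proofs are ported line by line.  THEOREMS ONLY — no `def`, no
instance, no notation, no named-fact hypothesis, no `sorry`; ★-only `Literature` imports.

HONEST LABEL: HC_CM is proved only modulo the 7 printed citations (2 remaining named inputs: hLiu418 = stmt-HodgeConjecture-24832, h413 =
stmt-HodgeConjecture-24833) until rung 0 closes.  Pure measure theory; discharges no socket — the local injectivity (LI) and the fibre count (FC) of the ε-twisted tube map
(M1), the twisted Jacobian (J̃♭), TUBE-EQ and (WEYL-COUNT-T) are hypotheses of the consumers (REL ≠ ★ ≠ BUILT).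

## The mathematics

SETTING.  `G` a locally compact, second countable Hausdorff group with a Haar measure `ν` which is also right invariant; `B ≤ G` a CLOSED subgroup with a Haar
measure `bm` (inversion invariant) and `μ₀ = ν ∕ bm` the invariant quotient measure on `G ⧸ B` (★ `quotientMeasure`); `S` a locally compact second countable Hausdorff space
(the PARAMETER space); `Ψ : G ⧸ B × S → G` CONTINUOUS and EQUIVARIANT: `Ψ(c • q, s) = c · Ψ(q, s) · e(c)` for some map `e : G → G` (plain conjugation: `e(c) = c⁻¹`; ε-twisted
conjugation: `e(c) = ε(c)⁻¹` — NO condition on `e`, since `x ↦ c x e(c)` preserves the two-sided invariant `ν`); `S₀ ⊆ S` a Borel set of «regular parameters» and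
`D = {(q, s) | s ∈ S₀}`; and the two STRUCTURAL HYPOTHESES the group theory of the family must supply (★ `ConjugationFamilyFibres` for `x t x⁻¹`; M1-TWIST for `x t ε(x)⁻¹`):
(LI) `Ψ` is locally injective on `D`; (FC) every fibre of `Ψ` over `Ψ(D)` has exactly `w` points in `D`.
* §1 `Ψ_* `-bookkeeping: `(G ⧸ B) × S` is Polish; `D` is Borel; the fibre-count pull-back `μ` of `ν` along `Ψ` (★ Federer) is `G`-INVARIANT ON RECTANGLES (`μ((c⁻¹ • A) ×ˢ W) = μ(A ×ˢ W)`
  — equivariance + invariance of `ν` under `x ↦ c x e(c)`, ★ `apply_preimage_eq_of_semiconj`) and satisfies `μ(E) ≤ w · ν(Ψ(E ∩ D))` (finite on compact sets).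
* §2 WEIL FACTORISATION `μ = μ₀ ⊗ σ` for a measure `σ` on `S`, finite on compact sets, σ-finite, carried by `S₀` (★ `exists_measure_prod_eq_mul` on the single orbit `G ⧸ B`, bounded
  rectangles first, then exhaustion of `S` by compact sets).
* §3 **THE RADIAL FORMULA** `exists_radialMeasure_lintegral_equivariantFamily`: `w · ∫_{Ψ(D)} f dν = ∫_S ∫_{G ⧸ B} f(Ψ(q, s)) dμ₀(q) dσ(s)` for Borel `f ≥ 0` (classically `dσ` = the Jacobian
  density times the parameter measure — NOT asserted); and its VANISHING FORM `setIntegral_image_equivariantFamily_eq_zero` (Bochner): if `g` is integrable on `Ψ(D)` and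
  `∫_{G ⧸ B} g(Ψ(q, s)) dμ₀ = 0` for all `s ∈ S₀` then `∫_{Ψ(D)} g dν = 0`.
USE.  With `B = T′ = G̃_{t ε}` (one subgroup for the whole ε-regular part of `T̃`, ★ `R90S4CartanNormMap`), `S = T̃` (or `T̃ ⧸ (1−ε)T̃`), `Ψ(xT′, t) = x t ε(x)⁻¹`, `e = ε(·)⁻¹`, the inner
integral is the class ε-orbital integral `Φ_ε(⟦t⟧, f)` (★ `R90S4TwistedTubeOrbitalBase` CAN-ID), and `σ` is identified through the norm by (J̃♭) + ★ M4 (`R90S4TwistedNormPush`) — the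
twisted Weyl integration formula of [Rogawski1990 §12.5 p. 186].  With `S = T`, `e(c) = c⁻¹` it is the plain ★ theorem (p. 182).

[cite: HarishChandra1970, Lemma 42] [cite: Weil1965, n° 49 Lemme 22 (p. 70)] [cite: Federer1969, §2.10.10] [cite: Rogawski1990, §12.5 pp. 182, 186] [cite: DeitmarEchterhoff2014, Thm. 1.5.3]
-/

set_option autoImplicit false
-- the mandated namespace repeats the single-problem summit's segment (`HodgeConjecture.HodgeConjecture`)
set_option linter.dupNamespace false

noncomputable section

open MeasureTheory Measure Set Filter Topology Function
open scoped ENNReal NNReal Pointwise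

namespace Summit.HodgeConjecture.HodgeConjecture.R90.S4

open Literature.MeasureTheory.Group

-- The quotient `G ⧸ B` and the parameter space `S` carry Borel σ-algebras supplied as instance ARGUMENTS (idiom of ★ `ConjugationWeylVanishing`).

section EquivariantFamily

variable {G : Type*} [Group G] [TopologicalSpace G] [IsTopologicalGroup G] [LocallyCompactSpace G]
  [SecondCountableTopology G] [T2Space G] [MeasurableSpace G] [BorelSpace G]
  (B : Subgroup G) (hB : IsClosed (B : Set G))
  [MeasurableSpace (G ⧸ B)] [BorelSpace (G ⧸ B)]
  (ν : Measure G) [ν.IsHaarMeasure] [ν.IsMulRightInvariant]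
  {S : Type*} [TopologicalSpace S] [LocallyCompactSpace S] [SecondCountableTopology S] [T2Space S] [MeasurableSpace S] [BorelSpace S]
  (Ψ : (G ⧸ B) × S → G) (hΨc : Continuous Ψ) (e : G → G) (hΨ : ∀ (c : G) (q : G ⧸ B) (s : S), Ψ (c • q, s) = c * Ψ (q, s) * e c)
  (S₀ : Set S) (hS₀ : MeasurableSet S₀)
  (hinj : ∀ z ∈ {p : (G ⧸ B) × S | p.2 ∈ S₀}, ∃ U : Set ((G ⧸ B) × S), IsOpen U ∧ z ∈ U ∧ InjOn Ψ (U ∩ {p : (G ⧸ B) × S | p.2 ∈ S₀}))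
  (w : ℕ) (hw : ∀ y ∈ Ψ '' {p : (G ⧸ B) × S | p.2 ∈ S₀}, Measure.count (Ψ ⁻¹' {y} ∩ {p : (G ⧸ B) × S | p.2 ∈ S₀}) = (w : ℝ≥0∞))

/-! ## §1 The fibre-count pull-back of `ν` along `Ψ`: Polish domain, Borel regular set, invariance on rectangles, mass bound -/

omit [T2Space G] [MeasurableSpace G] [BorelSpace G] [MeasurableSpace (G ⧸ B)] [BorelSpace (G ⧸ B)] [MeasurableSpace S] [BorelSpace S] in
include hB in
/-- `G ⧸ B × S` is Polish (`G ⧸ B` for `B` closed in a locally compact second countable Hausdorff group, and `S`, are locally compact second countable Hausdorff).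
[cite: Kechris1995, Thm. 5.3] -/
theorem polishSpace_quotient_prod_param : PolishSpace ((G ⧸ B) × S) := by
  haveI : IsClosed (B : Set G) := hB
  haveI : PolishSpace (G ⧸ B) := Literature.Topology.Metrizable.polishSpace_of_locallyCompactSpace_of_secondCountableTopology _
  haveI : PolishSpace S := Literature.Topology.Metrizable.polishSpace_of_locallyCompactSpace_of_secondCountableTopology S
  infer_instance

omit [TopologicalSpace G] [IsTopologicalGroup G] [LocallyCompactSpace G] [SecondCountableTopology G] [T2Space G] [MeasurableSpace G] [BorelSpace G]
  [BorelSpace (G ⧸ B)] [TopologicalSpace S] [LocallyCompactSpace S] [SecondCountableTopology S] [T2Space S] [BorelSpace S] in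
include hS₀ in
/-- The regular set `D = {(q, s) | s ∈ S₀}` is Borel. [cite: HarishChandra1970, Lemma 42] -/
theorem measurableSet_regularSet_equivariantFamily : MeasurableSet {p : (G ⧸ B) × S | p.2 ∈ S₀} :=
  measurable_snd hS₀

include hB hΨc hΨ hS₀ hinj in
/-- **Invariance of the fibre-count pull-back on rectangles**: for `c ∈ G`, Borel `A ⊆ G ⧸ B`, `W ⊆ S`: `μ((c • ·)⁻¹ A ×ˢ W) = μ(A ×ˢ W)` — equivariance
`Ψ(c • q, s) = c Ψ(q, s) e(c)` (★ `apply_preimage_eq_of_semiconj` with `α = (c • ·) × id`, `β = x ↦ c x e(c)`) and two-sided invariance of `ν`. [cite: HarishChandra1970, Lemma 42]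
[cite: Federer1969, §2.10.10] -/
theorem fibreCount_equivariantFamily_smul_invariant {μ : Measure ((G ⧸ B) × S)}
    (hμ : ∀ E : Set ((G ⧸ B) × S), MeasurableSet E →
      μ E = ∫⁻ y, Measure.count (Ψ ⁻¹' {y} ∩ (E ∩ {p : (G ⧸ B) × S | p.2 ∈ S₀})) ∂ν)
    (c : G) {A : Set (G ⧸ B)} (hA : MeasurableSet A) {W : Set S} (hW : MeasurableSet W) :
    μ (((c • ·) ⁻¹' A) ×ˢ W) = μ (A ×ˢ W) := by
  haveI : IsClosed (B : Set G) := hB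
  haveI : PolishSpace ((G ⧸ B) × S) := polishSpace_quotient_prod_param B hB
  have hDm := measurableSet_regularSet_equivariantFamily B S₀ hS₀
  -- the two bijections: `α = (c • ·) × id` on the domain, `β = x ↦ c x e(c)` on `G`
  set α : ((G ⧸ B) × S) ≃ ((G ⧸ B) × S) := (MulAction.toPerm c : (G ⧸ B) ≃ (G ⧸ B)).prodCongr (Equiv.refl S) with hα
  set β : G ≃ G := (Equiv.mulLeft c).trans (Equiv.mulRight (e c)) with hβ
  have hαm : Measurable α := by
    rw [hα, Equiv.prodCongr_apply]
    exact (measurable_const_smul c).prodMap measurable_id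
  have hβapp : ∀ x : G, β x = c * x * e c := fun x => rfl
  have hβm : Measurable β := by
    have : (β : G → G) = fun x => c * x * e c := funext hβapp
    rw [this]
    exact (measurable_const_mul c).mul_const (e c)
  have hcomm : ∀ z, Ψ (α z) = β (Ψ z) := by
    rintro ⟨q, s⟩
    rw [hβapp]
    exact hΨ c q s
  have hαD : ∀ z : (G ⧸ B) × S, α z ∈ {p : (G ⧸ B) × S | p.2 ∈ S₀} ↔ z ∈ {p : (G ⧸ B) × S | p.2 ∈ S₀} := fun _ => Iff.rfl
  have hν : ν.map β = ν := by
    have : (β : G → G) = (fun x => x * e c) ∘ (fun x => c * x) := funext fun x => by rw [hβapp]; rfl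
    rw [this, ← Measure.map_map (measurable_mul_const (e c)) (measurable_const_mul c), map_mul_left_eq_self, map_mul_right_eq_self]
  have key := apply_preimage_eq_of_semiconj hDm hΨc hinj hμ α β hαm hβm hcomm hαD hν (hA.prod hW)
  have hpre : α ⁻¹' (A ×ˢ W) = ((c • ·) ⁻¹' A) ×ˢ W := by
    ext ⟨q, s⟩
    simp only [hα, mem_preimage, Equiv.prodCongr_apply, Prod.map_apply, Equiv.coe_refl, id_eq, mem_prod, MulAction.toPerm_apply]
  rw [← hpre, key]

omit [ν.IsHaarMeasure] [ν.IsMulRightInvariant] in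
include hB hΨc hS₀ hinj hw in
/-- **Mass bound** for the fibre-count pull-back: `μ(E) ≤ w · ν(Ψ(E ∩ D))`; in particular `μ` is finite on compact sets. [cite: Federer1969, §2.10.10]
[cite: HarishChandra1970, Lemma 42] -/
theorem fibreCount_equivariantFamily_le {μ : Measure ((G ⧸ B) × S)}
    (hμ : ∀ E : Set ((G ⧸ B) × S), MeasurableSet E →
      μ E = ∫⁻ y, Measure.count (Ψ ⁻¹' {y} ∩ (E ∩ {p : (G ⧸ B) × S | p.2 ∈ S₀})) ∂ν)
    {E : Set ((G ⧸ B) × S)} (hE : MeasurableSet E) :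
    μ E ≤ (w : ℝ≥0∞) * ν (Ψ '' (E ∩ {p : (G ⧸ B) × S | p.2 ∈ S₀})) := by
  haveI : IsClosed (B : Set G) := hB
  haveI : PolishSpace ((G ⧸ B) × S) := polishSpace_quotient_prod_param B hB
  have hDm := measurableSet_regularSet_equivariantFamily B S₀ hS₀
  refine apply_le_mul_measure_image hDm hΨc hinj hμ (fun y => ?_) hE
  by_cases hy : y ∈ Ψ '' {p : (G ⧸ B) × S | p.2 ∈ S₀}
  · exact (hw y hy).le
  · have : Ψ ⁻¹' {y} ∩ {p : (G ⧸ B) × S | p.2 ∈ S₀} = ∅ := by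
      ext z
      simp only [mem_inter_iff, mem_preimage, mem_singleton_iff, mem_setOf_eq, mem_empty_iff_false, iff_false, not_and]
      exact fun hz hzR => hy ⟨z, hzR, hz⟩
    rw [this, measure_empty]
    exact zero_le

/-! ## §2 Weil factorisation `μ = (ν ∕ bm) ⊗ σ` with `σ` on the parameter space, carried by `S₀` -/

variable (bm : Measure B) [bm.IsMulLeftInvariant] [IsFiniteMeasureOnCompacts bm] [bm.IsOpenPosMeasure] [bm.IsInvInvariant]

include hB hΨc hΨ hS₀ hinj hw in
/-- **Weil factorisation of the fibre-count pull-back**: `μ = (ν ∕ bm) ⊗ σ` for a measure `σ` on `S`, finite on compact sets, σ-finite and carried by `S₀` — `μ` is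
`G`-invariant on rectangles and `G ⧸ B` is a single orbit (★ `exists_measure_prod_eq_mul`). [cite: Weil1965, n° 49 Lemme 22 (p. 70)] [cite: HarishChandra1970, Lemma 42] -/
theorem exists_radial_prod_eq_fibreCount_equivariantFamily {μ : Measure ((G ⧸ B) × S)}
    (hμ : ∀ E : Set ((G ⧸ B) × S), MeasurableSet E →
      μ E = ∫⁻ y, Measure.count (Ψ ⁻¹' {y} ∩ (E ∩ {p : (G ⧸ B) × S | p.2 ∈ S₀})) ∂ν) :
    ∃ σ : Measure S, IsFiniteMeasureOnCompacts σ ∧ SigmaFinite σ ∧ σ S₀ᶜ = 0 ∧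
      (quotientMeasure B bm hB ν).prod σ = μ := by
  classical
  haveI : IsClosed (B : Set G) := hB
  haveI : SigmaCompactSpace S := sigmaCompactSpace_of_locallyCompact_secondCountable
  have hwtop : (w : ℝ≥0∞) ≠ ⊤ := ENNReal.natCast_ne_top _
  set D : Set ((G ⧸ B) × S) := {p : (G ⧸ B) × S | p.2 ∈ S₀} with hD
  -- reference measure on the single orbit `G ⧸ B`
  set μ₀ : Measure (G ⧸ B) := quotientMeasure B bm hB ν with hμ₀
  haveI : SMulInvariantMeasure G (G ⧸ B) μ₀ := smulInvariantMeasure_quotientMeasure B bm hB ν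
  have hμ₀ne : μ₀ ≠ 0 := quotientMeasure_ne_zero B bm hB ν
  obtain ⟨A₀, hA₀c, hA₀⟩ := (Measure.Regular.exists_isCompact_not_null (μ := μ₀)).2 hμ₀ne
  have hA₀top : μ₀ A₀ ≠ ⊤ := hA₀c.measure_lt_top.ne
  -- finiteness of `μ` on compact sets
  have hfinK : ∀ K : Set ((G ⧸ B) × S), IsCompact K → μ K < ⊤ := by
    intro K hK
    refine (fibreCount_equivariantFamily_le B hB ν Ψ hΨc S₀ hS₀ hinj w hw hμ hK.measurableSet).trans_lt ?_
    refine ENNReal.mul_lt_top hwtop.lt_top ?_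
    exact (measure_mono (image_mono inter_subset_left)).trans_lt ((hK.image hΨc).measure_lt_top)
  -- `μ` only sees `D`
  have hμD : ∀ (A : Set (G ⧸ B)) (W : Set S), MeasurableSet A → MeasurableSet W → μ (A ×ˢ W) = μ (A ×ˢ (W ∩ S₀)) := by
    intro A W hA hW
    have h0 : μ (A ×ˢ (W \ S₀)) = 0 := by
      refine apply_eq_zero_of_inter_eq_empty hμ (hA.prod (hW.diff hS₀)) ?_
      rw [Set.eq_empty_iff_forall_notMem]
      rintro ⟨q, s⟩ ⟨⟨-, hs⟩, hs'⟩
      exact hs.2 hs'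
    have hdisj : Disjoint (A ×ˢ (W ∩ S₀)) (A ×ˢ (W \ S₀)) := Set.disjoint_prod.2 (Or.inr disjoint_sdiff_inter.symm)
    calc μ (A ×ˢ W) = μ (A ×ˢ (W ∩ S₀) ∪ A ×ˢ (W \ S₀)) := by rw [← Set.prod_union, inter_union_sdiff]
      _ = μ (A ×ˢ (W ∩ S₀)) + μ (A ×ˢ (W \ S₀)) := measure_union hdisj (hA.prod (hW.diff hS₀))
      _ = μ (A ×ˢ (W ∩ S₀)) := by rw [h0, add_zero]
  -- the radial measure
  set σ : Measure S := (μ₀ A₀)⁻¹ • ((μ.restrict (A₀ ×ˢ univ)).map Prod.snd) with hσ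
  have hσW : ∀ W : Set S, MeasurableSet W → σ W = (μ₀ A₀)⁻¹ * μ (A₀ ×ˢ W) := by
    intro W hW
    rw [hσ, Measure.smul_apply, smul_eq_mul, Measure.map_apply measurable_snd hW, Measure.restrict_apply (measurable_snd hW)]
    congr 2
    ext ⟨q, s⟩
    simp only [mem_inter_iff, mem_preimage, mem_prod, mem_univ, and_true]
    exact and_comm
  have hσfin : IsFiniteMeasureOnCompacts σ := by
    refine ⟨fun K hK => ?_⟩
    rw [hσW K hK.measurableSet]
    exact ENNReal.mul_lt_top (ENNReal.inv_lt_top.2 (pos_iff_ne_zero.2 hA₀)) (hfinK _ (hA₀c.prod hK))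
  have hσS : σ S₀ᶜ = 0 := by
    rw [hσW _ hS₀.compl, hμD A₀ _ hA₀c.measurableSet hS₀.compl, Set.compl_inter_self, Set.prod_empty, measure_empty, mul_zero]
  -- Weil's relative uniqueness on bounded `W`
  have hrect_bdd : ∀ (W : Set S), MeasurableSet W → (∃ K : Set S, IsCompact K ∧ W ⊆ K) →
      ∀ A : Set (G ⧸ B), MeasurableSet A → μ (A ×ˢ W) = μ₀ A * σ W := by
    intro W hW hWK A hA
    obtain ⟨K, hK, hWK⟩ := hWK
    have hμ₀c : μ₀ (MulAction.orbit G (QuotientGroup.mk (1 : G) : G ⧸ B))ᶜ = 0 := by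
      rw [MulAction.orbit_eq_univ, compl_univ, measure_empty]
    have hfin : ∀ K' : Set (G ⧸ B), IsCompact K' → μ (K' ×ˢ W) < ⊤ := fun K' hK' =>
      (measure_mono (prod_mono_right hWK)).trans_lt (hfinK _ (hK'.prod hK))
    have hinv : ∀ (c : G) (A' : Set (G ⧸ B)), MeasurableSet A' → μ (((c • ·) ⁻¹' A') ×ˢ W) = μ (A' ×ˢ W) :=
      fun c A' hA' => fibreCount_equivariantFamily_smul_invariant B hB ν Ψ hΨc e hΨ S₀ hS₀ hinj hμ c hA' hW
    have hcar : μ ((MulAction.orbit G (QuotientGroup.mk (1 : G) : G ⧸ B))ᶜ ×ˢ W) = 0 := by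
      rw [MulAction.orbit_eq_univ, compl_univ, Set.empty_prod, measure_empty]
    obtain ⟨c, hc⟩ := exists_measure_prod_eq_mul G (QuotientGroup.mk (1 : G) : G ⧸ B) μ₀ μ hμ₀c hμ₀ne hfin hinv hcar
    have hcσ : σ W = c := by
      rw [hσW W hW, hc A₀ hA₀c.measurableSet, ← mul_assoc, mul_comm ((μ₀ A₀)⁻¹), mul_assoc, ENNReal.inv_mul_cancel hA₀ hA₀top, mul_one]
    rw [hc A hA, hcσ, mul_comm]
  -- all rectangles, by exhaustion of `S` by compact sets
  have hrect : ∀ (A : Set (G ⧸ B)) (W : Set S), MeasurableSet A → MeasurableSet W → μ (A ×ˢ W) = μ₀ A * σ W := by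
    intro A W hA hW
    have hσsplit : σ W = σ (W ∩ S₀) := by
      have h0 : σ (W \ S₀) = 0 := measure_mono_null (fun s hs => hs.2) hσS
      calc σ W = σ (W ∩ S₀ ∪ W \ S₀) := by rw [inter_union_sdiff]
        _ = σ (W ∩ S₀) + σ (W \ S₀) := measure_union disjoint_sdiff_inter.symm (hW.diff hS₀)
        _ = σ (W ∩ S₀) := by rw [h0, add_zero]
    rw [hμD A W hA hW, hσsplit]
    set Wn : ℕ → Set S := fun n => W ∩ S₀ ∩ compactCovering S n with hWn
    have hWn_mono : Monotone Wn := fun m n hmn => inter_subset_inter_right _ (compactCovering_subset S hmn)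
    have hWn_union : (⋃ n, Wn n) = W ∩ S₀ := by
      rw [hWn, ← inter_iUnion, iUnion_compactCovering, inter_univ]
    have h1 : μ (A ×ˢ (W ∩ S₀)) = ⨆ n, μ (A ×ˢ Wn n) := by
      rw [← hWn_union, Set.prod_iUnion]
      exact (monotone_const.set_prod hWn_mono).measure_iUnion
    have h2 : σ (W ∩ S₀) = ⨆ n, σ (Wn n) := by
      rw [← hWn_union]
      exact hWn_mono.measure_iUnion
    rw [h1, h2, ENNReal.mul_iSup]
    refine iSup_congr fun n => ?_
    exact hrect_bdd (Wn n) ((hW.inter hS₀).inter (isCompact_compactCovering S n).measurableSet)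
      ⟨compactCovering S n, isCompact_compactCovering S n, inter_subset_right⟩ A hA
  haveI := hσfin
  haveI hσsf : SigmaFinite σ := SigmaFinite.of_isFiniteMeasureOnCompacts σ
  refine ⟨σ, hσfin, hσsf, hσS, Measure.prod_eq fun A W hA hW => (hrect A W hA hW)⟩

/-! ## §3 The radial formula on `Ψ(D)` and its vanishing form -/

include hΨc hΨ hS₀ hinj hw in
/-- **THE WEYL INTEGRATION FORMULA ON `Ψ(D)` WITH AN UNSPECIFIED RADIAL MEASURE — for any equivariant finite-fibre family.**  Under (LI) and (FC) there is a measure `σ` on the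
parameter space `S`, finite on compact sets, σ-finite and carried by `S₀`, such that for every Borel `f ≥ 0` on `G`
`w · ∫_{Ψ(D)} f dν = ∫_S ∫_{G ⧸ B} f(Ψ(q, s)) d(ν ∕ bm)(q) dσ(s)`.  (For `Ψ(xT′, t) = x t ε(x)⁻¹` this is the ε-twisted Weyl integration formula on one tube with `dσ` not yet
identified; classically `dσ = D_G(N t)² × `(norm pull-back of the Cartan measure), p. 186 — NOT asserted here.) [cite: HarishChandra1970, Lemma 42] [cite: Weil1965, n° 49 Lemme 22 (p. 70)]
[cite: Federer1969, §2.10.10] [cite: Rogawski1990, §12.5 pp. 182, 186] -/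
theorem exists_radialMeasure_lintegral_equivariantFamily :
    ∃ σ : Measure S, IsFiniteMeasureOnCompacts σ ∧ SigmaFinite σ ∧ σ S₀ᶜ = 0 ∧
      ∀ f : G → ℝ≥0∞, Measurable f →
        (w : ℝ≥0∞) * ∫⁻ y in Ψ '' {p : (G ⧸ B) × S | p.2 ∈ S₀}, f y ∂ν =
          ∫⁻ s, ∫⁻ q, f (Ψ (q, s)) ∂(quotientMeasure B bm hB ν) ∂σ := by
  haveI : IsClosed (B : Set G) := hB
  haveI : PolishSpace ((G ⧸ B) × S) := polishSpace_quotient_prod_param B hB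
  have hDm := measurableSet_regularSet_equivariantFamily B S₀ hS₀
  obtain ⟨μ, hμ⟩ := exists_measure_apply_eq_lintegral_count_fibre hDm hΨc hinj ν
  obtain ⟨σ, hσfin, hσsf, hσS, hprod⟩ :=
    exists_radial_prod_eq_fibreCount_equivariantFamily B hB ν Ψ hΨc e hΨ S₀ hS₀ hinj w hw bm hμ
  haveI := hσfin
  haveI := hσsf
  refine ⟨σ, hσfin, hσsf, hσS, fun f hf => ?_⟩
  rw [← lintegral_comp_eq_mul_setLIntegral_image hDm hΨc hinj hμ hw hf, ← hprod,
    lintegral_prod_symm (fun z : (G ⧸ B) × S => f (Ψ z)) (hf.comp hΨc.measurable).aemeasurable]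

include hΨc hΨ hS₀ hinj hw in
/-- **VANISHING FORM** — for any equivariant finite-fibre family with `w ≠ 0`: if `g : G → E` is `ν`-integrable on `Ψ(D)` and all its `Ψ`-orbital integrals
`∫_{G ⧸ B} g(Ψ(q, s)) d(ν ∕ bm)(q)`, `s ∈ S₀`, vanish, then `∫_{Ψ(D)} g dν = 0`. [cite: HarishChandra1970, Lemma 42] [cite: Weil1965, n° 49 Lemme 22 (p. 70)] -/
theorem setIntegral_image_equivariantFamily_eq_zero (hw0 : w ≠ 0) {E : Type*} [NormedAddCommGroup E] [NormedSpace ℝ E]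
    (g : G → E) (hg : IntegrableOn g (Ψ '' {p : (G ⧸ B) × S | p.2 ∈ S₀}) ν)
    (h0 : ∀ s ∈ S₀, ∫ q, g (Ψ (q, s)) ∂(quotientMeasure B bm hB ν) = 0) :
    ∫ y in Ψ '' {p : (G ⧸ B) × S | p.2 ∈ S₀}, g y ∂ν = 0 := by
  haveI : IsClosed (B : Set G) := hB
  haveI : PolishSpace ((G ⧸ B) × S) := polishSpace_quotient_prod_param B hB
  have hDm := measurableSet_regularSet_equivariantFamily B S₀ hS₀
  obtain ⟨μ, hμ⟩ := exists_measure_apply_eq_lintegral_count_fibre hDm hΨc hinj ν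
  have hwtop : (w : ℝ≥0∞) ≠ ⊤ := ENNReal.natCast_ne_top _
  have hw0' : (w : ℝ≥0∞).toReal ≠ 0 := by
    rw [ENNReal.toReal_natCast]
    exact_mod_cast hw0
  have hmap := map_eq_smul_restrict_image_of_count_fibre_eq hDm hΨc hinj hμ hw
  obtain ⟨σ, hσfin, hσsf, hσS, hprod⟩ :=
    exists_radial_prod_eq_fibreCount_equivariantFamily B hB ν Ψ hΨc e hΨ S₀ hS₀ hinj w hw bm hμ
  haveI := hσfin
  haveI := hσsf
  -- `g ∘ Ψ` is `μ`-integrable and `∫ g ∘ Ψ dμ = w • ∫_{Ψ D} g dν`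
  have hgm : AEStronglyMeasurable g (μ.map Ψ) := by
    rw [hmap]; exact hg.aestronglyMeasurable.smul_measure _
  have hint : Integrable (g ∘ Ψ) μ := by
    rw [← integrable_map_measure hgm hΨc.measurable.aemeasurable, hmap]
    exact hg.integrable.smul_measure hwtop
  have h1 : ∫ z, g (Ψ z) ∂μ = (w : ℝ≥0∞).toReal • ∫ y in Ψ '' {p : (G ⧸ B) × S | p.2 ∈ S₀}, g y ∂ν := by
    rw [← integral_map hΨc.measurable.aemeasurable hgm, hmap, integral_smul_measure]
  -- and by Fubini it vanishes
  have h2 : ∫ z, g (Ψ z) ∂μ = 0 := by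
    rw [← hprod] at hint ⊢
    rw [integral_prod_symm (fun z : (G ⧸ B) × S => g (Ψ z)) hint]
    have hae : ∀ᵐ s : S ∂σ, s ∈ S₀ := by
      filter_upwards [measure_eq_zero_iff_ae_notMem.1 hσS] with s hs
      simpa using hs
    calc ∫ s, ∫ q, g (Ψ (q, s)) ∂(quotientMeasure B bm hB ν) ∂σ = ∫ s, (0 : E) ∂σ := by
          refine integral_congr_ae ?_
          filter_upwards [hae] with s hs
          exact h0 s hs
      _ = 0 := integral_zero _ _
  rw [h2] at h1
  exact (smul_eq_zero.1 h1.symm).resolve_left hw0'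

end EquivariantFamily

end Summit.HodgeConjecture.HodgeConjecture.R90.S4

end
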